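import Literature.MathematicalPhysics.QuantumManyBody.GroundStateFeynmanKacProofs
import HarnessLib

/-!
# Route `BECCutLineWeakDisorder`, crux `GroundStateRigidity` (stmt-AtomisticToContinuum-9072),
# line `Sketch`: the registered stub `stub_stabilityOfJensen`

Supports (does not close) stmt-AtomisticToContinuum-9072. **Stability (a quantitative spectral gap
of the closed form) from the Feynman–Kac Jensen inequality.** Fix `N ≥ 1`, a measurable bounded
pair profile `v` and `L > 0`; write `Λ = Λ_L^N` for the open box, `T = e^{-H_N}` for the Feynman–Kac
semigroup at time one on `L²(Λ)` (`fkL2 v L 1` of `GroundStateFeynmanKacOperator`), `μ₀ = ‖T‖`,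
`E₀ = groundStateEnergy v N L` and `𝓔(f) = ∫|∇f|² + ∫Vf²` for real `C¹` functions `f` vanishing off
the box. ASSUMING the Jensen inequality `‖f‖² e^{-𝓔(f)/‖f‖²} ≤ ⟨f, T f⟩` on that core (the sibling
stub `stub_fkJensen`, taken here as an antecedent), we produce `κ > 0` and a measurable `e ≥ 0`
with `∫_Λ e² = 1` such that

`(E₀ + κ) ‖f‖² ≤ 𝓔(f) + κ ⟨e, f⟩_Λ²` for every real `C¹` Dirichlet `f`.

The vector `e` is (a pointwise nonnegative representative of) the Perron–Frobenius eigenvector of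
`T` (`fkL2_perronFrobenius`), `κ = 1 − M₁/μ₀` with `M₁ < μ₀` the bound of `T` on `e^⊥`
(`exists_gap_of_simple`), and `E₀ = −log μ₀` because the strictly positive Feynman–Kac ground
state of `GroundStateFeynmanKac_holds` is an eigenvector of `T` with eigenvalue `e^{-E₀}` that pairs
positively with `e`. The four steps:

* `rayleigh_le_of_gap` — Hilbert-space bookkeeping: `⟨f, Tf⟩ ≤ μ₀⟨e,f⟩² + M₁(‖f‖² − ⟨e,f⟩²)`;
* `exp_neg_tangent_le` — the tangent line `e^{-l} − e^{-x} ≤ e^{-l}(x − l)` of the convex `e^{-x}`;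
* `stability_from_jensen_bounds` — the real-variable assembly of Jensen, the gap bound and the
  tangent line at `x = 𝓔/‖f‖²`, `l = −log μ₀`, into `(−log μ₀ + κ)‖f‖² ≤ 𝓔 + κ⟨e,f⟩²`;
* `norm_fkL2_one_eq_exp_neg_groundStateEnergy` — `‖T‖ = e^{-E₀}`.

## References

* M. Reed, B. Simon, *Methods of Modern Mathematical Physics IV* (1978), Thm XIII.44
  (positivity improving ⇒ nondegenerate ground state, here made quantitative). [ReedSimonIV1978]
* K. L. Chung, Z. Zhao, *From Brownian Motion to Schrödinger's Equation* (1995), Thm 3.17,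
  Prop 3.29. [ChungZhao1995]
-/

noncomputable section

open MeasureTheory Filter Set
open scoped ENNReal NNReal Topology InnerProductSpace

namespace Summit.AtomisticToContinuum.BoseEinsteinCondensation.Theorems.GroundStateRigidity

open Literature.MathematicalPhysics.QuantumManyBody.BoseGas

/-! ### Hilbert-space bookkeeping: the Rayleigh quotient under a gap on `e^⊥` -/

/-- **The Rayleigh quotient under a spectral gap.** Let `T` be a symmetric bounded operator on a
real inner product space with a unit eigenvector `e` for the eigenvalue `‖T‖`, and suppose
`‖T x‖ ≤ M₁‖x‖` on `e^⊥`. Then for every `f`, writing `a = ⟨e, f⟩` and `f = a e + g` with `g ⊥ e`,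
`⟨f, T f⟩ = ‖T‖ a² + ⟨g, T g⟩ ≤ ‖T‖ a² + M₁ ‖g‖² = ‖T‖ a² + M₁ (‖f‖² − a²)`. [folklore] -/
theorem rayleigh_le_of_gap {E : Type*} [NormedAddCommGroup E] [InnerProductSpace ℝ E]
    (T : E →L[ℝ] E) (hsym : ∀ x y, ⟪T x, y⟫_ℝ = ⟪x, T y⟫_ℝ) {e : E} (he : ‖e‖ = 1)
    (hTe : T e = ‖T‖ • e) {M₁ : ℝ} (hgap : ∀ x, ⟪e, x⟫_ℝ = 0 → ‖T x‖ ≤ M₁ * ‖x‖) (f : E) :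
    ⟪f, T f⟫_ℝ ≤ ‖T‖ * ⟪e, f⟫_ℝ ^ 2 + M₁ * (‖f‖ ^ 2 - ⟪e, f⟫_ℝ ^ 2) := by
  set a : ℝ := ⟪e, f⟫_ℝ with ha
  set g : E := f - a • e with hg
  have hee : ⟪e, e⟫_ℝ = 1 := by rw [real_inner_self_eq_norm_sq, he, one_pow]
  have hge : ⟪e, g⟫_ℝ = 0 := by
    rw [hg, inner_sub_right, real_inner_smul_right, hee, ← ha]; ring
  have hge' : ⟪g, e⟫_ℝ = 0 := by rw [real_inner_comm]; exact hge
  have hf : f = a • e + g := by rw [hg]; abel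
  have hTg : ⟪e, T g⟫_ℝ = 0 := by
    rw [← hsym, hTe, real_inner_smul_left, hge, mul_zero]
  have hnorm : ‖f‖ ^ 2 = a ^ 2 + ‖g‖ ^ 2 := by
    rw [← real_inner_self_eq_norm_sq, ← real_inner_self_eq_norm_sq]
    conv_lhs => rw [hf]
    simp only [inner_add_left, inner_add_right, real_inner_smul_left, real_inner_smul_right,
      hee, hge, hge']
    ring
  have hpair : ⟪f, T f⟫_ℝ = ‖T‖ * a ^ 2 + ⟪g, T g⟫_ℝ := by
    conv_lhs => rw [hf]
    rw [map_add, map_smul, hTe, smul_smul]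
    simp only [inner_add_left, inner_add_right, real_inner_smul_left, real_inner_smul_right,
      hee, hTg, hge']
    ring
  have hgg : ⟪g, T g⟫_ℝ ≤ M₁ * ‖g‖ ^ 2 :=
    calc ⟪g, T g⟫_ℝ ≤ ‖g‖ * ‖T g‖ := real_inner_le_norm _ _
      _ ≤ ‖g‖ * (M₁ * ‖g‖) := mul_le_mul_of_nonneg_left (hgap g hge) (norm_nonneg _)
      _ = M₁ * ‖g‖ ^ 2 := by ring
  rw [hpair, hnorm]
  linarith

/-! ### Two real-variable lemmas -/

/-- **Tangent line of the convex function `x ↦ e^{-x}` at `l`**: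
`e^{-l} − e^{-x} ≤ e^{-l} (x − l)` for all real `l, x` (from `1 + y ≤ e^y` at `y = l − x`).
[folklore] -/
theorem exp_neg_tangent_le (l x : ℝ) :
    Real.exp (-l) - Real.exp (-x) ≤ Real.exp (-l) * (x - l) := by
  have h := Real.add_one_le_exp (l - x)
  have he : Real.exp (-x) = Real.exp (-l) * Real.exp (l - x) := by
    rw [← Real.exp_add]; ring_nf
  have h2 := mul_le_mul_of_nonneg_left h (Real.exp_pos (-l)).le
  rw [he]
  linarith

/-- **The real-variable assembly.** If `μ₀ > 0`, `κ μ₀ = μ₀ − M₁`, `n2 > 0`, the Jensen bound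
`n2 · e^{-En/n2} ≤ P` and the gap bound `P ≤ μ₀ a² + M₁ (n2 − a²)` hold, then
`(−log μ₀ + κ) n2 ≤ En + κ a²`: with `l = −log μ₀`, `μ₀ = e^{-l}`, the tangent line at
`x = En/n2` gives `(μ₀ − M₁)(n2 − a²) ≤ μ₀ n2 − P ≤ n2 (e^{-l} − e^{-En/n2}) ≤ μ₀ (En − l n2)`, and one
divides by `μ₀`. [folklore] -/
theorem stability_from_jensen_bounds {μ₀ M₁ κ n2 a P En : ℝ} (hμ₀ : 0 < μ₀)
    (hκμ : κ * μ₀ = μ₀ - M₁) (hn2 : 0 < n2) (hJ : n2 * Real.exp (-(En / n2)) ≤ P)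
    (hP : P ≤ μ₀ * a ^ 2 + M₁ * (n2 - a ^ 2)) :
    (-Real.log μ₀ + κ) * n2 ≤ En + κ * a ^ 2 := by
  set l : ℝ := -Real.log μ₀ with hl
  have hμl : Real.exp (-l) = μ₀ := by rw [hl, neg_neg, Real.exp_log hμ₀]
  have ht : μ₀ - Real.exp (-(En / n2)) ≤ μ₀ * (En / n2 - l) := by
    have h := exp_neg_tangent_le l (En / n2)
    rwa [hμl] at h
  have h1 : n2 * μ₀ - n2 * Real.exp (-(En / n2)) ≤ μ₀ * (En - l * n2) := by
    have h := mul_le_mul_of_nonneg_left ht hn2.le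
    have e1 : n2 * (En / n2) = En := mul_div_cancel₀ En hn2.ne'
    calc n2 * μ₀ - n2 * Real.exp (-(En / n2)) = n2 * (μ₀ - Real.exp (-(En / n2))) := by ring
      _ ≤ n2 * (μ₀ * (En / n2 - l)) := h
      _ = μ₀ * (n2 * (En / n2)) - μ₀ * l * n2 := by ring
      _ = μ₀ * (En - l * n2) := by rw [e1]; ring
  have h2 : (μ₀ - M₁) * (n2 - a ^ 2) ≤ μ₀ * (En - l * n2) := by linarith
  have h3 : κ * (n2 - a ^ 2) ≤ En - l * n2 := by
    refine le_of_mul_le_mul_left ?_ hμ₀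
    calc μ₀ * (κ * (n2 - a ^ 2)) = κ * μ₀ * (n2 - a ^ 2) := by ring
      _ = (μ₀ - M₁) * (n2 - a ^ 2) := by rw [hκμ]
      _ ≤ μ₀ * (En - l * n2) := h2
  linarith

/-! ### `‖e^{-H_N}‖ = e^{-E₀}` -/

variable {N : ℕ}

/-- **The top of the spectrum of `T = e^{-H_N}` on `L²(Λ)` is `e^{-E₀}`**, `E₀` the variational
ground-state energy: the strictly positive Feynman–Kac ground state `Ψ₀` of
`GroundStateFeynmanKac_holds` is an `L²(Λ)` eigenvector of `T` with eigenvalue `e^{-E₀}`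
(`IsGroundStateFK.eigen` at time one), and pairing it with an a.e. positive eigenvector `e` for
`‖T‖` gives `‖T‖⟨e, Ψ₀⟩ = ⟨Te, Ψ₀⟩ = ⟨e, TΨ₀⟩ = e^{-E₀}⟨e, Ψ₀⟩` with `⟨e, Ψ₀⟩ > 0`.
[cite: ReedSimonIV1978, Thm XIII.44] -/
theorem norm_fkL2_one_eq_exp_neg_groundStateEnergy (hN : 1 ≤ N) {v : ℝ → ℝ≥0∞}
    (hv : Measurable v) {C : ℝ≥0} (hC : ∀ r, v r ≤ C) {L : ℝ} (hL : 0 < L)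
    {e : Lp ℝ 2 (volume.restrict (boxN N L))}
    (hTe : fkL2 v L 1 e = ‖fkL2 (N := N) v L 1‖ • e)
    (hepos : ∀ᵐ X ∂volume.restrict (boxN N L), 0 < (e : Config N → ℝ) X) :
    ‖fkL2 (N := N) v L 1‖ = Real.exp (-(groundStateEnergy v N L).toReal) := by
  obtain ⟨Ψ₀, hΨ, hcont, hpos⟩ := GroundStateFeynmanKac_holds N L v hN hL hv ⟨C, hC⟩
  -- the class of `Ψ₀` in `L²(Λ)`
  have hsupp : HasCompactSupport Ψ₀ :=
    HasCompactSupport.intro' (isBounded_boxN N L).isCompact_closure isClosed_closure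
      fun x hx => hΨ.eq_zero x fun h => hx (subset_closure h)
  have hmem : MemLp Ψ₀ 2 (volume.restrict (boxN N L)) :=
    (hcont.memLp_of_hasCompactSupport hsupp).restrict _
  set ψL : Lp ℝ 2 (volume.restrict (boxN N L)) := hmem.toLp Ψ₀ with hψLdef
  have hψL : (ψL : Config N → ℝ) =ᵐ[volume.restrict (boxN N L)] Ψ₀ := hmem.coeFn_toLp
  -- the eigen-relation at time one, in `L²(Λ)`
  have heig : fkL2 v L 1 ψL = Real.exp (-(groundStateEnergy v N L).toReal) • ψL := by
    refine Lp.ext ?_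
    filter_upwards [fkL2_coeFn hv L one_pos ψL,
      Lp.coeFn_smul (Real.exp (-(groundStateEnergy v N L).toReal)) ψL, hψL] with X h1 h2 h3
    rw [h1, h2, Pi.smul_apply, h3, smul_eq_mul, fkReal_congr_ae_restrict v L one_pos hψL X,
      fkReal_eq_toReal_fkSemigroup hv L 1 hΨ.measurable hΨ.nonneg X, hΨ.eigen 1 zero_le_one X,
      mul_one, ENNReal.toReal_ofReal (mul_nonneg (Real.exp_pos _).le (hΨ.nonneg X))]
  -- `Ψ₀ > 0` a.e. on the box, so `⟨e, Ψ₀⟩ > 0`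
  have hψpos : ∀ᵐ X ∂volume.restrict (boxN N L), 0 < (ψL : Config N → ℝ) X := by
    filter_upwards [hψL, ae_restrict_mem (measurableSet_boxN N L)] with X h1 h2
    rw [h1]; exact hpos X h2
  have hip : 0 < ⟪e, ψL⟫_ℝ := inner_pos_of_ae_pos (restrict_boxN_ne_zero N hL) hepos hψpos
  have h1 : ⟪fkL2 v L 1 e, ψL⟫_ℝ = ‖fkL2 (N := N) v L 1‖ * ⟪e, ψL⟫_ℝ := by
    rw [hTe, real_inner_smul_left]
  have h2 : ⟪fkL2 v L 1 e, ψL⟫_ℝ = Real.exp (-(groundStateEnergy v N L).toReal) * ⟪e, ψL⟫_ℝ := by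
    rw [inner_fkL2_comm hv L one_pos, heig, real_inner_smul_right]
  exact mul_right_cancel₀ hip.ne' (h1.symm.trans h2)

/-! ### The stub -/

/-- **Stub `stub_stabilityOfJensen` — stability (quantitative spectral gap of the closed form) from
the Jensen inequality.** For `N ≥ 1`, measurable bounded `v` and `L > 0`, IF the Feynman–Kac Jensen
inequality `‖f‖² e^{-𝓔(f)/‖f‖²} ≤ ∫_Λ f · e^{-H_N} f` holds for all real `C¹` Dirichlet `f`, THEN
there are `κ > 0` and a measurable `e ≥ 0` with `∫_Λ e² = 1` such that every real `C¹` Dirichlet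
`f` obeys `(E₀ + κ) ∫ f² ≤ ∫|∇f|² + ∫Vf² + κ (∫_Λ e f)²`, `E₀ = (groundStateEnergy v N L).toReal`:
`e` is the Perron–Frobenius vector of `T = e^{-H_N}` on `L²(Λ)` (`fkL2_perronFrobenius`), `M₁ < ‖T‖`
its bound on `e^⊥` (`exists_gap_of_simple`), `κ = 1 − M₁/‖T‖`, and `E₀ = −log ‖T‖`
(`norm_fkL2_one_eq_exp_neg_groundStateEnergy`); Jensen, `⟨Tf, f⟩ ≤ ‖T‖⟨e,f⟩² + M₁(‖f‖² − ⟨e,f⟩²)`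
and the tangent line of `e^{-x}` at `−log ‖T‖` combine to the claim. Reed–Simon IV Thm XIII.44,
made quantitative. [cite: ReedSimonIV1978, Thm XIII.44] -/
theorem stub_stabilityOfJensen :
    ∀ (N : ℕ) (v : ℝ → ℝ≥0∞) (C : ℝ≥0) (L : ℝ), 1 ≤ N → Measurable v → (∀ r, v r ≤ C) → 0 < L →
      (∀ f : Config N → ℝ, ContDiff ℝ 1 f → (∀ X, X ∉ boxN N L → f X = 0) →
        (∫ X, f X ^ 2) * Real.exp (-(((∫⁻ X, realKinetic f X).toReal +
            (∫⁻ X, interaction v X * ‖f X‖ₑ ^ 2).toReal) / ∫ X, f X ^ 2)) ≤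
          ∫ X in boxN N L, f X * fkReal v L 1 f X) →
      ∃ κ : ℝ, 0 < κ ∧ ∃ e : Config N → ℝ, Measurable e ∧ (∀ X, 0 ≤ e X) ∧
        ∫ X in boxN N L, e X ^ 2 = 1 ∧
        ∀ f : Config N → ℝ, ContDiff ℝ 1 f → (∀ X, X ∉ boxN N L → f X = 0) →
          ((groundStateEnergy v N L).toReal + κ) * ∫ X, f X ^ 2 ≤
            (∫⁻ X, realKinetic f X).toReal + (∫⁻ X, interaction v X * ‖f X‖ₑ ^ 2).toReal +
              κ * (∫ X in boxN N L, e X * f X) ^ 2 := by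
  intro N v C L hN hv hC hL hJensen
  set μ : Measure (Config N) := volume.restrict (boxN N L) with hμ
  -- Perron–Frobenius data and the spectral gap at time one
  obtain ⟨hT0, e, he1, he0, hTe, hepos, hsimple⟩ := fkL2_perronFrobenius (N := N) hv hC hL one_pos
  have hsym : ∀ x y : Lp ℝ 2 μ, ⟪fkL2 v L 1 x, y⟫_ℝ = ⟪x, fkL2 v L 1 y⟫_ℝ := fun x y =>
    inner_fkL2_comm hv L one_pos x y
  have hposT : ∀ x : Lp ℝ 2 μ, 0 ≤ ⟪fkL2 v L 1 x, x⟫_ℝ := fun x =>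
    inner_fkL2_self_nonneg hv L one_pos x
  obtain ⟨M₁, hM₁, -, hgap⟩ := exists_gap_of_simple (fkL2 v L 1) hsym hposT
    (isCompactOperator_fkL2 hv hC hL one_pos) hT0 he1 hTe hsimple
  have hμ₀E : ‖fkL2 (N := N) v L 1‖ = Real.exp (-(groundStateEnergy v N L).toReal) :=
    norm_fkL2_one_eq_exp_neg_groundStateEnergy hN hv hC hL hTe hepos
  set μ₀ : ℝ := ‖fkL2 (N := N) v L 1‖ with hμ₀def
  have hμ₀ : 0 < μ₀ := norm_pos_iff.2 hT0
  have hlog : (groundStateEnergy v N L).toReal = -Real.log μ₀ := by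
    rw [hμ₀E, Real.log_exp, neg_neg]
  -- the constant `κ = 1 - M₁/μ₀` and the nonnegative representative of `e`
  set κ : ℝ := (μ₀ - M₁) / μ₀ with hκdef
  have hκ : 0 < κ := div_pos (sub_pos.2 hM₁) hμ₀
  have hκμ : κ * μ₀ = μ₀ - M₁ := div_mul_cancel₀ _ hμ₀.ne'
  obtain ⟨eR, heR⟩ : ∃ eR : Config N → ℝ, eR = fun X => max ((e : Config N → ℝ) X) 0 :=
    ⟨_, rfl⟩
  have heRm : Measurable eR := by
    rw [heR]; exact (measurable_coeFn_Lp e).max measurable_const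
  have heR0 : ∀ X, 0 ≤ eR X := fun X => by rw [heR]; exact le_max_right _ _
  have heRe : eR =ᵐ[μ] (e : Config N → ℝ) := by
    filter_upwards [(Lp.coeFn_nonneg e).2 he0] with X hX
    rw [heR]; exact max_eq_left hX
  have heR1 : ∫ X in boxN N L, eR X ^ 2 = 1 := by
    have h : ‖e‖ ^ 2 = ∫ X in boxN N L, eR X ^ 2 := by
      rw [← real_inner_self_eq_norm_sq, inner_Lp_eq_integral]
      refine integral_congr_ae ?_
      filter_upwards [heRe] with X hX
      rw [hX, sq]
    rw [← h, he1, one_pow]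
  refine ⟨κ, hκ, eR, heRm, heR0, heR1, fun f hf1 hzero => ?_⟩
  -- the trial function, its `L²(Λ)` class, and the identifications with the Hilbert-space data
  have hcont : Continuous f := hf1.continuous
  have hsupp : HasCompactSupport f :=
    HasCompactSupport.intro' (isBounded_boxN N L).isCompact_closure isClosed_closure
      fun x hx => hzero x fun h => hx (subset_closure h)
  have hmem : MemLp f 2 μ := (hcont.memLp_of_hasCompactSupport hsupp).restrict _
  set fL : Lp ℝ 2 μ := hmem.toLp f with hfLdef
  have hfL : (fL : Config N → ℝ) =ᵐ[μ] f := hmem.coeFn_toLp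
  have hn2_nn : 0 ≤ ∫ X, f X ^ 2 := integral_nonneg fun X => sq_nonneg _
  have hEn0 : 0 ≤ (∫⁻ X, realKinetic f X).toReal +
      (∫⁻ X, interaction v X * ‖f X‖ₑ ^ 2).toReal :=
    add_nonneg ENNReal.toReal_nonneg ENNReal.toReal_nonneg
  have hn2eq : ‖fL‖ ^ 2 = ∫ X, f X ^ 2 := by
    rw [← setIntegral_eq_integral_of_forall_compl_eq_zero (s := boxN N L)
        (fun X (hX : X ∉ boxN N L) => show f X ^ 2 = 0 by rw [hzero X hX]; ring),
      ← real_inner_self_eq_norm_sq, inner_Lp_eq_integral]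
    refine integral_congr_ae ?_
    filter_upwards [hfL] with X hX
    rw [hX, sq]
  have hPeq : ⟪fL, fkL2 v L 1 fL⟫_ℝ = ∫ X in boxN N L, f X * fkReal v L 1 f X := by
    rw [inner_Lp_eq_integral]
    refine integral_congr_ae ?_
    filter_upwards [hfL, fkL2_coeFn hv L one_pos fL] with X h1 h2
    rw [h1, h2, fkReal_congr_ae_restrict v L one_pos hfL X]
  have haeq : ⟪e, fL⟫_ℝ = ∫ X in boxN N L, eR X * f X := by
    rw [inner_Lp_eq_integral]
    refine integral_congr_ae ?_
    filter_upwards [heRe, hfL] with X h1 h2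
    rw [h2, ← h1]
  -- the two bounds on the pairing `⟨f, T f⟩`: Jensen from below, the gap from above
  have hJ := hJensen f hf1 hzero
  rw [← hPeq] at hJ
  have hP : ⟪fL, fkL2 v L 1 fL⟫_ℝ ≤
      μ₀ * ⟪e, fL⟫_ℝ ^ 2 + M₁ * ((∫ X, f X ^ 2) - ⟪e, fL⟫_ℝ ^ 2) := by
    rw [← hn2eq]; exact rayleigh_le_of_gap (fkL2 v L 1) hsym he1 hTe hgap fL
  rw [← haeq, hlog]
  rcases eq_or_lt_of_le hn2_nn with h0 | hn2pos
  · rw [← h0, mul_zero]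
    exact add_nonneg hEn0 (mul_nonneg hκ.le (sq_nonneg _))
  · exact stability_from_jensen_bounds hμ₀ hκμ hn2pos hJ hP

end Summit.AtomisticToContinuum.BoseEinsteinCondensation.Theorems.GroundStateRigidity

end
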